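import Literature.AnabelianGeometry.SemiGraphs.UniversalCoveringObj
import Literature.AnabelianGeometry.SemiGraphs.UniversalCoveringOver
import Literature.AnabelianGeometry.SemiGraphs.TemperedVerticialInjective
import Literature.AlgebraicGeometry.Frobenioids.QuasiTemperoidConnected
import Mathlib.CategoryTheory.Limits.Shapes.BinaryProducts
import HarnessLib

/-!
# Connected components of coverings and connected objects of `B^temp(𝒢)` ([SemiAnbd] §3 pp. 36–37)

[SemiAnbd] §3 p. 37 speaks of the "connected components" of a covering `𝒢' → 𝒢` (object `S` of
`B^cov(𝒢)`; `CovObj.SameComponent` of `TemperedCoverings.lean`) and, from Def. 3.1 (iv) /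
Def. 3.5 (iii) on, of *connected* objects in the categorical sense of the §0 dictionary
(`IsConnectedObj`).  This file relates the two for `B^temp(𝒢)`: images of points under morphisms
preserve adjacency and components (`CovHom.mapPoint`); morphisms agreeing at a point agree on its
component (`CovHom.mapPoint_eq_of_sameComponent`); the trivial coverings `CovObj.trivialCov X` are
tempered and morphisms into them are colourings constant on components (`CovObj.colorHom`); a
pointless object is initial and a non-initial object has a point; and **an object of `B^temp(𝒢)`
with a point and a single component is connected** (`isConnectedObj_of_sameComponent`:
two-colour the summands of a putative coproduct decomposition).
-/

namespace Literature.AnabelianGeometry.SemiGraphs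

namespace ProfiniteSemiGraph

open CategoryTheory CategoryTheory.Limits
open Literature.AlgebraicGeometry.Frobenioids (IsConnectedObj IsNonemptyObj)
open Literature.AlgebraicGeometry.Frobenioids.QuasiTemperoid.BTempConnected (ρ_one_apply
  ρ_mul_apply ρ_inv_apply)

universe u

variable {𝒢 : ProfiniteSemiGraph.{u}}

/-- The image of a point under a morphism of coverings. [cite: MochizukiSemiAnbd2006, §3 p.36] -/
def CovHom.mapPoint {S T : CovObj 𝒢} (f : S ⟶ T) : S.Point → T.Point
  | Sum.inl ⟨v, x⟩ => Sum.inl ⟨v, (f.fV v).hom.hom x⟩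
  | Sum.inr ⟨e, y⟩ => Sum.inr ⟨e, (f.fE e).hom.hom y⟩

/-- `mapPoint` of a composite. [cite: MochizukiSemiAnbd2006, §3 p.36] -/
theorem CovHom.mapPoint_comp {S T U : CovObj 𝒢} (f : S ⟶ T) (g : T ⟶ U) (p : S.Point) :
    CovHom.mapPoint (f ≫ g) p = CovHom.mapPoint g (CovHom.mapPoint f p) := by
  rcases p with ⟨v, x⟩ | ⟨e, y⟩ <;> rfl

/-- Equivariance of the vertex components, pointwise. [cite: MochizukiSemiAnbd2006, §3 p.36] -/
theorem CovHom.fV_ρ_apply {S T : CovObj 𝒢} (f : S ⟶ T) (v : 𝒢.graph.Vertex) (g : 𝒢.Gv v)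
    (x : (S.SV v).obj.V) : (f.fV v).hom.hom ((S.SV v).obj.ρ g x) = (T.SV v).obj.ρ g ((f.fV v).hom.hom x) :=
  ConcreteCategory.congr_hom ((f.fV v).hom.comm g) x

/-- Equivariance of the edge components, pointwise. [cite: MochizukiSemiAnbd2006, §3 p.36] -/
theorem CovHom.fE_ρ_apply {S T : CovObj 𝒢} (f : S ⟶ T) (e : 𝒢.graph.Edge) (g : 𝒢.Ge e)
    (y : (S.SE e).obj.V) : (f.fE e).hom.hom ((S.SE e).obj.ρ g y) = (T.SE e).obj.ρ g ((f.fE e).hom.hom y) :=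
  ConcreteCategory.congr_hom ((f.fE e).hom.comm g) y

/-- Compatibility with the gluings, pointwise: `f_v (glue y) = glue (f_e y)`.
[cite: MochizukiSemiAnbd2006, §3 p.36] -/
theorem CovHom.fV_glue_apply {S T : CovObj 𝒢} (f : S ⟶ T) (b : 𝒢.graph.Branch) (v : 𝒢.graph.Vertex)
    (h : 𝒢.graph.abuts b = some v) (y : (S.SE (𝒢.graph.edgeOf b)).obj.V) :
    (f.fV v).hom.hom ((S.glue b v h).hom.hom.hom y) = (T.glue b v h).hom.hom.hom ((f.fE _).hom.hom y) :=
  (congrArg (fun φ : S.SE (𝒢.graph.edgeOf b) ⟶ (BTemp.res (𝒢.brHom b v h)).obj (T.SV v) =>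
    φ.hom.hom y) (f.comm b v h)).symm

/-- Morphisms preserve adjacency of points. [cite: MochizukiSemiAnbd2006, Def 3.5(ii) p.37] -/
theorem CovHom.mapPoint_adj {S T : CovObj 𝒢} (f : S ⟶ T) {p q : S.Point} (h : S.Adj p q) :
    T.Adj (CovHom.mapPoint f p) (CovHom.mapPoint f q) := by
  cases h with
  | vertex v g x =>
    change T.Adj (Sum.inl ⟨v, _⟩) (Sum.inl ⟨v, (f.fV v).hom.hom ((S.SV v).obj.ρ g x)⟩)
    rw [CovHom.fV_ρ_apply]
    exact CovObj.Adj.vertex v g _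
  | edge e g y =>
    change T.Adj (Sum.inr ⟨e, _⟩) (Sum.inr ⟨e, (f.fE e).hom.hom ((S.SE e).obj.ρ g y)⟩)
    rw [CovHom.fE_ρ_apply]
    exact CovObj.Adj.edge e g _
  | glue b v hb y =>
    change T.Adj (Sum.inr ⟨_, (f.fE _).hom.hom y⟩)
      (Sum.inl ⟨v, (f.fV v).hom.hom ((S.glue b v hb).hom.hom.hom y)⟩)
    rw [CovHom.fV_glue_apply]
    exact CovObj.Adj.glue b v hb _

/-- Morphisms preserve connected components. [cite: MochizukiSemiAnbd2006, Def 3.5(ii) p.37] -/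
theorem CovHom.mapPoint_sameComponent {S T : CovObj 𝒢} (f : S ⟶ T) {p q : S.Point}
    (h : S.SameComponent p q) : T.SameComponent (CovHom.mapPoint f p) (CovHom.mapPoint f q) := by
  induction h with
  | rel _ _ h => exact Relation.EqvGen.rel _ _ (CovHom.mapPoint_adj f h)
  | refl _ => exact Relation.EqvGen.refl _
  | symm _ _ _ ih => exact ih.symm _ _
  | trans _ _ _ _ _ ih₁ ih₂ => exact ih₁.trans _ _ _ ih₂

/-- Two morphisms agree at a point adjacent to a point where they agree, and conversely (the
actions are by bijections and the gluings are bijections). [cite: MochizukiSemiAnbd2006, §3 p.36] -/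
theorem CovHom.mapPoint_eq_iff_of_adj {S T : CovObj 𝒢} (φ ψ : S ⟶ T) {p q : S.Point}
    (h : S.Adj p q) : CovHom.mapPoint φ p = CovHom.mapPoint ψ p ↔
      CovHom.mapPoint φ q = CovHom.mapPoint ψ q := by
  cases h with
  | vertex v g x =>
    change (Sum.inl ⟨v, (φ.fV v).hom.hom x⟩ : T.Point) = Sum.inl ⟨v, (ψ.fV v).hom.hom x⟩ ↔
      (Sum.inl ⟨v, (φ.fV v).hom.hom ((S.SV v).obj.ρ g x)⟩ : T.Point) =
        Sum.inl ⟨v, (ψ.fV v).hom.hom ((S.SV v).obj.ρ g x)⟩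
    rw [CovHom.fV_ρ_apply, CovHom.fV_ρ_apply]
    constructor
    · intro h
      have := (Sigma.mk.inj_iff.mp (Sum.inl.inj h)).2
      rw [eq_of_heq this]
    · intro h
      have h' := eq_of_heq (Sigma.mk.inj_iff.mp (Sum.inl.inj h)).2
      have := congrArg (fun z => (T.SV v).obj.ρ g⁻¹ z) h'
      simp only [ρ_inv_apply] at this
      rw [this]
  | edge e g y =>
    change (Sum.inr ⟨e, (φ.fE e).hom.hom y⟩ : T.Point) = Sum.inr ⟨e, (ψ.fE e).hom.hom y⟩ ↔
      (Sum.inr ⟨e, (φ.fE e).hom.hom ((S.SE e).obj.ρ g y)⟩ : T.Point) =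
        Sum.inr ⟨e, (ψ.fE e).hom.hom ((S.SE e).obj.ρ g y)⟩
    rw [CovHom.fE_ρ_apply, CovHom.fE_ρ_apply]
    constructor
    · intro h
      have := (Sigma.mk.inj_iff.mp (Sum.inr.inj h)).2
      rw [eq_of_heq this]
    · intro h
      have h' := eq_of_heq (Sigma.mk.inj_iff.mp (Sum.inr.inj h)).2
      have := congrArg (fun z => (T.SE e).obj.ρ g⁻¹ z) h'
      simp only [ρ_inv_apply] at this
      rw [this]
  | glue b v hb y =>
    change (Sum.inr ⟨_, (φ.fE _).hom.hom y⟩ : T.Point) = Sum.inr ⟨_, (ψ.fE _).hom.hom y⟩ ↔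
      (Sum.inl ⟨v, (φ.fV v).hom.hom ((S.glue b v hb).hom.hom.hom y)⟩ : T.Point) =
        Sum.inl ⟨v, (ψ.fV v).hom.hom ((S.glue b v hb).hom.hom.hom y)⟩
    rw [CovHom.fV_glue_apply, CovHom.fV_glue_apply]
    constructor
    · intro h
      have := (Sigma.mk.inj_iff.mp (Sum.inr.inj h)).2
      rw [eq_of_heq this]
    · intro h
      have h' := eq_of_heq (Sigma.mk.inj_iff.mp (Sum.inl.inj h)).2
      have := congrArg (fun z => (T.glue b v hb).inv.hom.hom z) h'
      rw [CovObj.glue_inv_hom, CovObj.glue_inv_hom] at this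
      rw [this]

/-- Agreement of two morphisms at a point propagates along the component, in both directions.
[cite: MochizukiSemiAnbd2006, §3 p.36] -/
theorem CovHom.mapPoint_eq_iff_of_sameComponent {S T : CovObj 𝒢} (φ ψ : S ⟶ T) {p q : S.Point}
    (hpq : S.SameComponent p q) :
    CovHom.mapPoint φ p = CovHom.mapPoint ψ p ↔ CovHom.mapPoint φ q = CovHom.mapPoint ψ q := by
  induction hpq with
  | rel _ _ h => exact CovHom.mapPoint_eq_iff_of_adj φ ψ h
  | refl _ => exact Iff.rfl
  | symm _ _ _ ih => exact ih.symm
  | trans _ _ _ _ _ ih₁ ih₂ => exact ih₁.trans ih₂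

/-- **Rigidity along components**: two morphisms of coverings that agree at a point agree at every
point of its connected component. [cite: MochizukiSemiAnbd2006, §3 p.36] -/
theorem CovHom.mapPoint_eq_of_sameComponent {S T : CovObj 𝒢} (φ ψ : S ⟶ T) {p q : S.Point}
    (hpq : S.SameComponent p q) (hp : CovHom.mapPoint φ p = CovHom.mapPoint ψ p) :
    CovHom.mapPoint φ q = CovHom.mapPoint ψ q :=
  (CovHom.mapPoint_eq_iff_of_sameComponent φ ψ hpq).mp hp

/-- A morphism out of a covering with a single connected component is determined by its value at
one point. [cite: MochizukiSemiAnbd2006, §3 p.36] -/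
theorem CovHom.ext_of_sameComponent {S T : CovObj 𝒢} (φ ψ : S ⟶ T) (p : S.Point)
    (hconn : ∀ q, S.SameComponent p q) (hp : CovHom.mapPoint φ p = CovHom.mapPoint ψ p) : φ = ψ := by
  refine CovHom.ext (funext fun v => ?_) (funext fun e => ?_)
  · apply ObjectProperty.hom_ext
    apply Action.Hom.ext
    apply ConcreteCategory.hom_ext
    intro x
    have h := CovHom.mapPoint_eq_of_sameComponent φ ψ (hconn (Sum.inl ⟨v, x⟩)) hp
    exact eq_of_heq (Sigma.mk.inj_iff.mp (Sum.inl.inj h)).2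
  · apply ObjectProperty.hom_ext
    apply Action.Hom.ext
    apply ConcreteCategory.hom_ext
    intro y
    have h := CovHom.mapPoint_eq_of_sameComponent φ ψ (hconn (Sum.inr ⟨e, y⟩)) hp
    exact eq_of_heq (Sigma.mk.inj_iff.mp (Sum.inr.inj h)).2

/-! ### Trivial coverings and colourings -/

section Trivial

variable (𝒢) (X : Type u) [Countable X]

/-- The *trivial covering* with fibre `X`: every constituent fibre is `X` with the trivial action,
all gluings are the identity (the disjoint union of `X` copies of `𝒢`).
[cite: MochizukiSemiAnbd2006, Def 3.5(i) p.37] -/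
def CovObj.trivialCov : CovObj 𝒢 where
  SV v := BTemp.trivialObj (𝒢.Gv v) X
  SE e := BTemp.trivialObj (𝒢.Ge e) X
  glue _ _ _ := BTemp.isoOfEquiv (Equiv.refl X) fun _ _ => rfl

/-- The trivial covering with one sheet is finite. [cite: MochizukiSemiAnbd2006, Def 3.5(i) p.37] -/
theorem CovObj.trivialCov_punit_isFinite : (CovObj.trivialCov 𝒢 PUnit.{u + 1}).IsFinite :=
  ⟨fun _ => inferInstanceAs (Finite PUnit), fun _ => inferInstanceAs (Finite PUnit)⟩

/-- The trivial covering with one sheet has nonempty fibres. [cite: MochizukiSemiAnbd2006, Def 3.5(i) p.37] -/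
theorem CovObj.trivialCov_punit_hasNonemptyFibres :
    (CovObj.trivialCov 𝒢 PUnit.{u + 1}).HasNonemptyFibres :=
  ⟨fun _ => ⟨PUnit.unit⟩, fun _ => ⟨PUnit.unit⟩⟩

/-- Every covering splits a trivial covering (its actions are trivial).
[cite: MochizukiSemiAnbd2006, Def 3.5(ii) p.37] -/
theorem CovObj.splitsAt_trivialCov (F : CovObj 𝒢) (q : (CovObj.trivialCov 𝒢 X).Point) :
    F.SplitsAt (CovObj.trivialCov 𝒢 X) q := by
  rcases q with ⟨v, s⟩ | ⟨e, s⟩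
  · intro _ _ _; rfl
  · intro _ _ _; rfl

/-- **Trivial coverings are tempered** (split by the one-sheeted trivial covering).
[cite: MochizukiSemiAnbd2006, Def 3.5(ii) p.37] -/
theorem CovObj.trivialCov_isTempered : (CovObj.trivialCov 𝒢 X).IsTempered := fun _ =>
  ⟨CovObj.trivialCov 𝒢 PUnit.{u + 1}, CovObj.trivialCov_punit_isFinite 𝒢,
    CovObj.trivialCov_punit_hasNonemptyFibres 𝒢, fun q _ => CovObj.splitsAt_trivialCov 𝒢 X _ q⟩

/-- The trivial covering with fibre `X` as an object of `B^temp(𝒢)`.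
[cite: MochizukiSemiAnbd2006, Def 3.5(ii) p.37] -/
def trivialCovT : BTempCat 𝒢 := ⟨CovObj.trivialCov 𝒢 X, CovObj.trivialCov_isTempered 𝒢 X⟩

variable {𝒢 X}

/-- The colour (fibre coordinate) of a point of a trivial covering.
[cite: MochizukiSemiAnbd2006, Def 3.5(i) p.37] -/
def CovObj.trivColor : (CovObj.trivialCov 𝒢 X).Point → X
  | Sum.inl ⟨_, x⟩ => x
  | Sum.inr ⟨_, x⟩ => x

/-- Adjacent points of a trivial covering have the same colour.
[cite: MochizukiSemiAnbd2006, Def 3.5(ii) p.37] -/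
theorem CovObj.trivColor_eq_of_adj {p q : (CovObj.trivialCov 𝒢 X).Point}
    (h : (CovObj.trivialCov 𝒢 X).Adj p q) : CovObj.trivColor p = CovObj.trivColor q := by
  cases h with
  | vertex v g x => rfl
  | edge e g y => rfl
  | glue b v hb y => rfl

/-- Points of a trivial covering in the same component have the same colour.
[cite: MochizukiSemiAnbd2006, Def 3.5(ii) p.37] -/
theorem CovObj.trivColor_eq_of_sameComponent {p q : (CovObj.trivialCov 𝒢 X).Point}
    (h : (CovObj.trivialCov 𝒢 X).SameComponent p q) : CovObj.trivColor p = CovObj.trivColor q := by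
  induction h with
  | rel _ _ h => exact CovObj.trivColor_eq_of_adj h
  | refl _ => rfl
  | symm _ _ _ ih => exact ih.symm
  | trans _ _ _ _ _ ih₁ ih₂ => exact ih₁.trans ih₂

variable (𝒢 X) in
/-- **Colourings.** A colouring of the points of `S` by `X`, constant along adjacency, is a
morphism `S ⟶ trivialCov X`. [cite: MochizukiSemiAnbd2006, Def 3.5(ii) p.37] -/
def CovObj.colorHom (S : CovObj 𝒢) (κ : S.Point → X) (hκ : ∀ p q, S.Adj p q → κ p = κ q) :
    S ⟶ CovObj.trivialCov 𝒢 X where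
  fV v := ObjectProperty.homMk
    { hom := TypeCat.ofHom fun x => κ (Sum.inl ⟨v, x⟩)
      comm := fun g => ConcreteCategory.hom_ext _ _ fun x =>
        (hκ _ _ (CovObj.Adj.vertex v g x)).symm }
  fE e := ObjectProperty.homMk
    { hom := TypeCat.ofHom fun y => κ (Sum.inr ⟨e, y⟩)
      comm := fun g => ConcreteCategory.hom_ext _ _ fun y =>
        (hκ _ _ (CovObj.Adj.edge e g y)).symm }
  comm b v h := by
    apply ObjectProperty.hom_ext
    apply Action.Hom.ext
    apply ConcreteCategory.hom_ext
    intro y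
    exact hκ _ _ (CovObj.Adj.glue b v h y)

/-- The colouring morphism has the prescribed colours. [cite: MochizukiSemiAnbd2006, Def 3.5(ii) p.37] -/
theorem CovObj.trivColor_mapPoint_colorHom (S : CovObj 𝒢) (κ : S.Point → X)
    (hκ : ∀ p q, S.Adj p q → κ p = κ q) (p : S.Point) :
    CovObj.trivColor (CovHom.mapPoint (CovObj.colorHom 𝒢 X S κ hκ) p) = κ p := by
  rcases p with ⟨v, x⟩ | ⟨e, y⟩ <;> rfl

end Trivial

/-! ### Initial objects and points -/

/-- A pointless object of `B^cov(𝒢)` has empty vertex fibres.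
[cite: MochizukiSemiAnbd2006, Def 3.5(ii) p.37] -/
theorem CovObj.isEmpty_V_of_isEmpty_point (S : CovObj 𝒢) (h : IsEmpty S.Point)
    (v : 𝒢.graph.Vertex) : IsEmpty (S.SV v).obj.V :=
  ⟨fun x => h.false (Sum.inl ⟨v, x⟩)⟩

/-- A pointless object of `B^cov(𝒢)` has empty edge fibres.
[cite: MochizukiSemiAnbd2006, Def 3.5(ii) p.37] -/
theorem CovObj.isEmpty_E_of_isEmpty_point (S : CovObj 𝒢) (h : IsEmpty S.Point)
    (e : 𝒢.graph.Edge) : IsEmpty (S.SE e).obj.V :=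
  ⟨fun x => h.false (Sum.inr ⟨e, x⟩)⟩

/-- A pointless object of `B^cov(𝒢)` is initial (it is the empty covering: the arrow to any
object is the family of empty maps, and it is unique). [cite: MochizukiSemiAnbd2006, §3 p.36] -/
theorem CovObj.nonempty_isInitial_of_isEmpty (S : CovObj 𝒢) (h : IsEmpty S.Point) :
    Nonempty (IsInitial S) := by
  refine ⟨IsInitial.ofUniqueHom (fun T => ?_) fun T f => ?_⟩
  · exact
      { fV := fun v => ObjectProperty.homMk
          { hom := TypeCat.ofHom fun x => ((S.isEmpty_V_of_isEmpty_point h v).false x).elim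
            comm := fun _ => ConcreteCategory.hom_ext _ _ fun x =>
              ((S.isEmpty_V_of_isEmpty_point h v).false x).elim }
        fE := fun e => ObjectProperty.homMk
          { hom := TypeCat.ofHom fun x => ((S.isEmpty_E_of_isEmpty_point h e).false x).elim
            comm := fun _ => ConcreteCategory.hom_ext _ _ fun x =>
              ((S.isEmpty_E_of_isEmpty_point h e).false x).elim }
        comm := fun b v hb => by
          apply ObjectProperty.hom_ext
          apply Action.Hom.ext
          apply ConcreteCategory.hom_ext
          intro x
          exact ((S.isEmpty_E_of_isEmpty_point h _).false x).elim }
  · refine CovHom.ext (funext fun v => ?_) (funext fun e => ?_)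
    · apply ObjectProperty.hom_ext
      apply Action.Hom.ext
      apply ConcreteCategory.hom_ext
      intro x
      exact ((S.isEmpty_V_of_isEmpty_point h v).false x).elim
    · apply ObjectProperty.hom_ext
      apply Action.Hom.ext
      apply ConcreteCategory.hom_ext
      intro x
      exact ((S.isEmpty_E_of_isEmpty_point h e).false x).elim

/-- A pointless object of `B^temp(𝒢)` is initial in `B^temp(𝒢)`. [cite: MochizukiSemiAnbd2006, Def 3.5(ii) p.37] -/
theorem nonempty_isInitial_of_isEmpty_point (S : BTempCat 𝒢) (h : IsEmpty S.obj.Point) :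
    Nonempty (IsInitial S) := by
  obtain ⟨hI⟩ := S.obj.nonempty_isInitial_of_isEmpty h
  refine ⟨IsInitial.ofUniqueHom (fun T => ObjectProperty.homMk (hI.to T.obj)) fun T f => ?_⟩
  apply ObjectProperty.hom_ext
  exact hI.hom_ext _ _

/-- A non-initial ("nonempty", §0) object of `B^temp(𝒢)` has a point.
[cite: MochizukiSemiAnbd2006, Def 3.5(ii) p.37] -/
theorem nonempty_point_of_isNonemptyObj (S : BTempCat 𝒢) (hS : IsNonemptyObj S) :
    Nonempty S.obj.Point := by
  by_contra h
  rw [not_nonempty_iff] at h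
  obtain ⟨hI⟩ := nonempty_isInitial_of_isEmpty_point S h
  exact hS.false hI

/-- A (categorically) connected object of `B^temp(𝒢)` has a point.
[cite: MochizukiSemiAnbd2006, Def 3.5(ii) p.37] -/
theorem nonempty_point_of_isConnectedObj (S : BTempCat 𝒢) (hS : IsConnectedObj S) :
    Nonempty S.obj.Point :=
  nonempty_point_of_isNonemptyObj S hS.1

/-! ### Combinatorially connected objects are connected -/

/-- Two colourings of a covering with a point differ. [cite: MochizukiSemiAnbd2006, Def 3.5(ii) p.37] -/
theorem colorHom_false_ne_true (S : BTempCat 𝒢) (p : S.obj.Point) :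
    (ObjectProperty.homMk (CovObj.colorHom 𝒢 (ULift.{u} Bool) S.obj (fun _ => ⟨false⟩)
        (fun _ _ _ => rfl)) : S ⟶ trivialCovT 𝒢 (ULift.{u} Bool)) ≠
      ObjectProperty.homMk (CovObj.colorHom 𝒢 (ULift.{u} Bool) S.obj (fun _ => ⟨true⟩)
        (fun _ _ _ => rfl)) := by
  intro h
  have h' := congrArg (fun f : S ⟶ trivialCovT 𝒢 (ULift.{u} Bool) =>
    CovObj.trivColor (CovHom.mapPoint f.hom p)) h
  simp only [ObjectProperty.homMk_hom, CovObj.trivColor_mapPoint_colorHom] at h'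
  exact Bool.false_ne_true (congrArg ULift.down h')

/-- An object of `B^temp(𝒢)` with a point is non-initial ("nonempty" in the sense of §0).
[cite: MochizukiSemiAnbd2006, Def 3.5(ii) p.37] -/
theorem isNonemptyObj_of_point (S : BTempCat 𝒢) (p : S.obj.Point) : IsNonemptyObj S :=
  ⟨fun hI => colorHom_false_ne_true S p (hI.hom_ext _ _)⟩

/-- **An object of `B^temp(𝒢)` with a point and a single connected component is connected** in the
categorical sense of the §0 dictionary: in a coproduct decomposition `S ≅ B₁ ⊔ B₂` with `B₁, B₂`
non-initial, colour `B₁` by `0` and `B₂` by `1`; the induced colouring of `S` is constant on the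
(unique) component, yet takes both values at the images of points of `B₁` and `B₂`.
[cite: MochizukiSemiAnbd2006, Def 3.5(iii) p.37] -/
theorem isConnectedObj_of_sameComponent (S : BTempCat 𝒢) (p₀ : S.obj.Point)
    (hconn : ∀ q, S.obj.SameComponent p₀ q) : IsConnectedObj S := by
  refine ⟨isNonemptyObj_of_point S p₀, fun B₁ B₂ ι₁ ι₂ h₁ h₂ => ⟨fun hc => ?_⟩⟩
  obtain ⟨b₁⟩ := nonempty_point_of_isNonemptyObj B₁ h₁
  obtain ⟨b₂⟩ := nonempty_point_of_isNonemptyObj B₂ h₂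
  let T : BTempCat 𝒢 := trivialCovT 𝒢 (ULift.{u} Bool)
  let c₁ : B₁ ⟶ T := ObjectProperty.homMk
    (CovObj.colorHom 𝒢 (ULift.{u} Bool) B₁.obj (fun _ => ⟨false⟩) (fun _ _ _ => rfl))
  let c₂ : B₂ ⟶ T := ObjectProperty.homMk
    (CovObj.colorHom 𝒢 (ULift.{u} Bool) B₂.obj (fun _ => ⟨true⟩) (fun _ _ _ => rfl))
  let u : S ⟶ T := hc.desc (BinaryCofan.mk c₁ c₂)
  have hu₁ : ι₁ ≫ u = c₁ := hc.fac (BinaryCofan.mk c₁ c₂) ⟨WalkingPair.left⟩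
  have hu₂ : ι₂ ≫ u = c₂ := hc.fac (BinaryCofan.mk c₁ c₂) ⟨WalkingPair.right⟩
  -- the colours of the images of `b₁`, `b₂` under `u`
  have e₁ : CovObj.trivColor (CovHom.mapPoint u.hom (CovHom.mapPoint ι₁.hom b₁)) = ⟨false⟩ := by
    rw [← CovHom.mapPoint_comp]
    change CovObj.trivColor (CovHom.mapPoint (ι₁ ≫ u).hom b₁) = _
    rw [hu₁]
    exact CovObj.trivColor_mapPoint_colorHom (X := ULift.{u} Bool) B₁.obj (fun _ => ⟨false⟩)
      (fun _ _ _ => rfl) b₁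
  have e₂ : CovObj.trivColor (CovHom.mapPoint u.hom (CovHom.mapPoint ι₂.hom b₂)) = ⟨true⟩ := by
    rw [← CovHom.mapPoint_comp]
    change CovObj.trivColor (CovHom.mapPoint (ι₂ ≫ u).hom b₂) = _
    rw [hu₂]
    exact CovObj.trivColor_mapPoint_colorHom (X := ULift.{u} Bool) B₂.obj (fun _ => ⟨true⟩)
      (fun _ _ _ => rfl) b₂
  -- but the two image points lie in one component of `S`, so their colours agree
  have hsame : S.obj.SameComponent (CovHom.mapPoint ι₁.hom b₁) (CovHom.mapPoint ι₂.hom b₂) :=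
    ((hconn _).symm _ _).trans _ _ _ (hconn _)
  have hcol := CovObj.trivColor_eq_of_sameComponent (CovHom.mapPoint_sameComponent u.hom hsame)
  exact Bool.false_ne_true (congrArg ULift.down (e₁.symm.trans (hcol.trans e₂)))

end ProfiniteSemiGraph

end Literature.AnabelianGeometry.SemiGraphs
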